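import Summits.ValiantsHypothesis.ValiantsHypothesis.Theorems.DivisionGapPerDivisionHardStubSparseRigidFlow
import Literature.Computability.AlgebraicComplexity.PermanentIrreducible
import Mathlib.GroupTheory.Perm.Cycle.Type
import Mathlib.Data.ZMod.Basic

/-!
# Crux `DivisionGap.PerDivisionHard` (stmt-ValiantsHypothesis-5065), line `pair-descent-jss-endpoint` —
stub `stub_qPotential`: arithmetic rigidity of the block arsenal

`stub_qPotential`: if two permutation monomials `x^{μ_σ}`, `x^{μ_σ'}` (`permMonomial`) agree at
every cell outside a placed block graph `G = placedBlock eR eC` (`G(b,k) ⊕ M₀`, `k ≥ 1`, the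
defs `BlockV`, `blockAdj`, `placedBlock` of `Theorems/DivisionGapDefs.lean`), then either `σ = σ'`
or `2k + 1` divides the order of `τ = σ⁻¹ σ'`.

Proof.
1. Moved columns live in `G` (`adj_of_ne`): for a column `c` with `σ c ≠ σ' c` both cells
   `(σ c, c)` and `(σ' c, c)` lie in `G` (otherwise agreement off `G` forces `σ c = σ' c`);
   moreover `τ c = σ⁻¹ (σ' c)` is again moved and `σ (τ c) = σ' c`, so the row `σ' c` carries the
   two distinct `G`-cells `(σ' c, c)` and `(σ' c, τ c)`.
2. Potential: a function `Φ : row label → column label → ZMod (2k+1)` with `Φ R (core column) = -k`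
   and `Φ R (internal column (i,j,t)) = t + 1` if `R` is the internal row with the same label
   ("forward": `σ'` sends the column to that row) and `-t` otherwise (hypotheses `hcore`, `hiv`;
   the explicit `Sum.elim` term is supplied in `stub_qPotential`).  A case analysis over the label
   of the shared row `σ' c` with the neighbourhood lemmas of `StubSparseRigidFlow.lean`
   (`adj_coreRow`, `adj_internalRow`, `adj_paddingRow`, `adj_internalCol`) gives
   `Φ (σ' (τ c)) (τ c) = Φ (σ' c) c + 1` for every moved column (`pot_step`, `colPot_step`).
3. Orbit sum (`cast_card_support_cycleOf_eq_zero`, `dvd_orderOf_of_potential`): summing the step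
   identity over the `τ`-cycle of a moved column (`Equiv.Perm.cycleOf`, reindexed by
   `Equiv.Perm.sum_comp`) shows that `2k + 1` divides its length, which is the order of that cycle
   (`Equiv.Perm.IsCycle.orderOf`) and divides `orderOf τ` (`Equiv.Perm.orderOf_cycleOf_dvd_orderOf`).
-/

noncomputable section

-- `Summit.ValiantsHypothesis.ValiantsHypothesis.…` is the tree's mandated single-conjunct layout
-- (Sub = Summit), so the duplicated namespace component is intended.
set_option linter.dupNamespace false

namespace Summit.ValiantsHypothesis.ValiantsHypothesis.Theorems.DivisionGapPerDivisionHard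

open MvPolynomial Literature.Computability.AlgebraicComplexity

variable {b k m n : ℕ}

/-! ### Orbit sums -/

/-- **Orbit sum.**  If a `ZMod N`-valued potential increases by one along `τ` at every moved
point, then the length of the `τ`-cycle of a moved point vanishes in `ZMod N`. [folklore] -/
theorem cast_card_support_cycleOf_eq_zero {N : ℕ} (τ : Equiv.Perm (Fin n)) (Ψ : Fin n → ZMod N)
    (hstep : ∀ c, τ c ≠ c → Ψ (τ c) = Ψ c + 1) {c₀ : Fin n} (hc₀ : τ c₀ ≠ c₀) :
    (((τ.cycleOf c₀).support.card : ℕ) : ZMod N) = 0 := by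
  have hsub : {a | (τ.cycleOf c₀) a ≠ a} ⊆ ((τ.cycleOf c₀).support : Set (Fin n)) :=
    fun a ha => Finset.mem_coe.mpr (Equiv.Perm.mem_support.mpr ha)
  have hsum := Equiv.Perm.sum_comp (τ.cycleOf c₀) (τ.cycleOf c₀).support Ψ hsub
  have hterm : ∀ y ∈ (τ.cycleOf c₀).support, Ψ ((τ.cycleOf c₀) y) = Ψ y + 1 := by
    intro y hy
    have hyc : τ.SameCycle c₀ y := (Equiv.Perm.mem_support_cycleOf_iff' hc₀).mp hy
    have hy' : τ y ≠ y := Equiv.Perm.mem_support.mp (Equiv.Perm.support_cycleOf_le τ c₀ hy)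
    rw [Equiv.Perm.cycleOf_apply, if_pos hyc]
    exact hstep y hy'
  rw [Finset.sum_congr rfl hterm, Finset.sum_add_distrib, Finset.sum_const, nsmul_one] at hsum
  linear_combination hsum

/-- **Arithmetic rigidity, abstract form.**  If a `ZMod N`-valued potential increases by one
along a nontrivial permutation `τ` at every moved point, then `N ∣ orderOf τ`. [folklore] -/
theorem dvd_orderOf_of_potential {N : ℕ} (τ : Equiv.Perm (Fin n)) (Ψ : Fin n → ZMod N)
    (hstep : ∀ c, τ c ≠ c → Ψ (τ c) = Ψ c + 1) (hτ : τ ≠ 1) : N ∣ orderOf τ := by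
  obtain ⟨c₀, hc₀⟩ : ∃ c, τ c ≠ c := by
    by_contra hall
    push Not at hall
    exact hτ (Equiv.ext fun c => (hall c).trans (Equiv.Perm.one_apply c).symm)
  have hdvd := Equiv.Perm.orderOf_cycleOf_dvd_orderOf τ c₀
  rw [(Equiv.Perm.isCycle_cycleOf τ hc₀).orderOf] at hdvd
  refine dvd_trans ?_ hdvd
  rw [← ZMod.natCast_eq_zero_iff]
  exact cast_card_support_cycleOf_eq_zero τ Ψ hstep hc₀

/-! ### Arithmetic in `ZMod (2k+1)` -/

/-- Wrapping around the core column: `(t + 1) + 1 = -k` in `ZMod (2k+1)` when `t + 1 = k`.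
[folklore] -/
theorem zmod_wrap_fwd {k t : ℕ} (h : t + 1 = k) :
    ((t : ZMod (2 * k + 1)) + 1) + 1 = -((k : ℕ) : ZMod (2 * k + 1)) := by
  subst h
  have h0 : ((2 * (t + 1) + 1 : ℕ) : ZMod (2 * (t + 1) + 1)) = 0 := ZMod.natCast_self _
  push_cast at h0 ⊢
  linear_combination h0

/-- Entering the core column backwards: `-t = -k + 1` in `ZMod (2k+1)` when `t + 1 = k`.
[folklore] -/
theorem zmod_wrap_bwd {k t : ℕ} (h : t + 1 = k) :
    -(t : ZMod (2 * k + 1)) = -((k : ℕ) : ZMod (2 * k + 1)) + 1 := by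
  subst h
  push_cast
  ring

/-! ### Labels of the block arsenal -/

/-- The row preceding an internal column differs from the internal row of the same label.
[folklore] -/
theorem prevRow_ne_iv (i j : Fin b) (t : Fin k) : (prevRow i j t : BlockV b k m) ≠ iv i j t := by
  unfold prevRow
  split_ifs with h
  · simp [iv]
  · simp only [iv, ne_eq, Sum.inr.injEq, Sum.inl.injEq, Prod.mk.injEq, true_and]
    exact fun h' => by have := congrArg Fin.val h'; simp at this; omega

/-- An internal row differs from the next internal column of its path. [folklore] -/
theorem iv_ne_iv_succ (i j : Fin b) (t : Fin k) (ht : (t : ℕ) + 1 < k) :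
    (iv i j t : BlockV b k m) ≠ iv i j ⟨t + 1, ht⟩ := by
  simp only [iv, ne_eq, Sum.inr.injEq, Sum.inl.injEq, Prod.mk.injEq, true_and]
  exact fun h' => by have := congrArg Fin.val h'; simp at this

/-! ### The potential in label coordinates -/

section Potential

/-
The potential `Φ R C` of a column label `C`, given the label `R` of the row to which `σ'` sends
that column, is characterised by its values on core and internal columns (padding columns are
never moved, their value is irrelevant).
-/
variable (Φ : BlockV b k m → BlockV b k m → ZMod (2 * k + 1))
  (hcore : ∀ (R : BlockV b k m) (j : Fin b), Φ R (Sum.inl j) = -((k : ℕ) : ZMod (2 * k + 1)))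
  (hiv : ∀ (R : BlockV b k m) (i j : Fin b) (t : Fin k), Φ R (iv i j t) =
    if R = iv i j t then ((t : ℕ) : ZMod (2 * k + 1)) + 1 else -((t : ℕ) : ZMod (2 * k + 1)))
include hcore hiv

/-- **The step of the potential (label form, `k ≥ 1`).**  If a row `R` carries two distinct
adjacent columns `C ≠ C'`, and `C'` is also adjacent to a second row `R' ≠ R`, then the potential
of `C'` seen from `R'` exceeds the potential of `C` seen from `R` by one. [folklore] -/
theorem pot_step (hk : 0 < k) {R R' C C' : BlockV b k m}
    (hRC : blockAdj b k m R C = true) (hRC' : blockAdj b k m R C' = true) (hCC' : C ≠ C')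
    (hR'C' : blockAdj b k m R' C' = true) (hRR' : R' ≠ R) :
    Φ R' C' = Φ R C + 1 := by
  rcases R with i | ⟨i, j, t⟩ | u
  · -- core row `i`: `C = (i, j, 0)` backward, `C' = (i, j', 0)` forward from `R' = (i, j', 0)`
    obtain ⟨j, rfl⟩ := adj_coreRow hk hRC
    obtain ⟨j', rfl⟩ := adj_coreRow hk hRC'
    rcases adj_internalCol hR'C' with rfl | h
    · have hne : (Sum.inl i : BlockV b k m) ≠ iv i j ⟨0, hk⟩ := by simp [iv]
      rw [hiv, if_pos rfl, hiv, if_neg hne]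
      simp
    · rw [prevRow_zero] at h
      exact absurd h hRR'
  · -- internal row `(i, j, t)`
    rcases adj_internalRow (i := i) (j := j) (t := t) hRC with rfl | rfl <;>
      rcases adj_internalRow (i := i) (j := j) (t := t) hRC' with rfl | rfl
    · exact absurd rfl hCC'
    · -- `C = (i, j, t)` forward, `C' = nextCol i j t`
      rw [hiv, if_pos rfl]
      by_cases ht : (t : ℕ) + 1 < k
      · have hnext : (nextCol i j t : BlockV b k m) = iv i j ⟨t + 1, ht⟩ := by
          rw [nextCol, dif_pos ht]
        rw [hnext] at hR'C' ⊢
        rcases adj_internalCol hR'C' with rfl | h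
        · rw [hiv, if_pos rfl]
          simp only [Nat.cast_add, Nat.cast_one]
        · rw [prevRow_succ i j t ht] at h
          exact absurd h hRR'
      · have hnext : (nextCol i j t : BlockV b k m) = Sum.inl j := by rw [nextCol, dif_neg ht]
        rw [hnext, hcore]
        exact (zmod_wrap_fwd (by omega)).symm
    · -- `C = nextCol i j t`, `C' = (i, j, t)` backward from `R' = prevRow i j t`
      rcases adj_internalCol hR'C' with h | rfl
      · exact absurd h hRR'
      · rw [hiv, if_neg (prevRow_ne_iv i j t)]
        by_cases ht : (t : ℕ) + 1 < k
        · have hnext : (nextCol i j t : BlockV b k m) = iv i j ⟨t + 1, ht⟩ := by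
            rw [nextCol, dif_pos ht]
          rw [hnext, hiv, if_neg (iv_ne_iv_succ i j t ht)]
          simp only [Nat.cast_add, Nat.cast_one]
          ring
        · have hnext : (nextCol i j t : BlockV b k m) = Sum.inl j := by rw [nextCol, dif_neg ht]
          rw [hnext, hcore]
          exact zmod_wrap_bwd (by omega)
    · exact absurd rfl hCC'
  · -- padding row: a single adjacent column
    exact absurd ((adj_paddingRow hRC).trans (adj_paddingRow hRC').symm) hCC'

end Potential

/-! ### The potential on the columns of the matrix -/

section Placed

variable (eR eC : BlockV b k m ≃ Fin n) (σ σ' : Equiv.Perm (Fin n))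

/-- **Moved columns live in `G`.**  If `x^{μ_σ}` and `x^{μ_σ'}` agree off the placed block graph
and `σ c ≠ σ' c`, then both cells `(σ' c, c)` and `(σ c, c)` belong to it. [folklore] -/
theorem adj_of_ne (hoff : ∀ e ∉ placedBlock eR eC, permMonomial σ e = permMonomial σ' e)
    {c : Fin n} (hc : σ c ≠ σ' c) :
    blockAdj b k m (eR.symm (σ' c)) (eC.symm c) = true ∧
      blockAdj b k m (eR.symm (σ c)) (eC.symm c) = true := by
  constructor
  · by_contra hnot
    have h1 := hoff (σ' c, c)
      (by simpa only [placedBlock, Finset.mem_filter, Finset.mem_univ, true_and] using hnot)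
    rw [permMonomial_apply, permMonomial_apply, if_neg hc, if_pos rfl] at h1
    exact absurd h1 (by norm_num)
  · by_contra hnot
    have h1 := hoff (σ c, c)
      (by simpa only [placedBlock, Finset.mem_filter, Finset.mem_univ, true_and] using hnot)
    rw [permMonomial_apply, permMonomial_apply, if_pos rfl, if_neg (Ne.symm hc)] at h1
    exact absurd h1 (by norm_num)

variable (Φ : BlockV b k m → BlockV b k m → ZMod (2 * k + 1))
  (hcore : ∀ (R : BlockV b k m) (j : Fin b), Φ R (Sum.inl j) = -((k : ℕ) : ZMod (2 * k + 1)))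
  (hiv : ∀ (R : BlockV b k m) (i j : Fin b) (t : Fin k), Φ R (iv i j t) =
    if R = iv i j t then ((t : ℕ) : ZMod (2 * k + 1)) + 1 else -((t : ℕ) : ZMod (2 * k + 1)))
include hcore hiv

/-- **The step of the column potential.**  For a moved column `c` (`σ c ≠ σ' c`), the column
`σ⁻¹ (σ' c)` seen from its `σ'`-row has potential one more than `c` seen from `σ' c`. [folklore] -/
theorem colPot_step (hk : 0 < k)
    (hoff : ∀ e ∉ placedBlock eR eC, permMonomial σ e = permMonomial σ' e)
    {c : Fin n} (hc : σ c ≠ σ' c) :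
    Φ (eR.symm (σ' (σ.symm (σ' c)))) (eC.symm (σ.symm (σ' c))) =
      Φ (eR.symm (σ' c)) (eC.symm c) + 1 := by
  -- the moved column `c' = τ c`
  have hσc' : σ (σ.symm (σ' c)) = σ' c := σ.apply_symm_apply _
  have hc'c : σ.symm (σ' c) ≠ c := fun h => hc (by rw [← hσc', h])
  have hc' : σ (σ.symm (σ' c)) ≠ σ' (σ.symm (σ' c)) := fun h =>
    hc'c (σ'.injective (by rw [← h, hσc']))
  have h1 := adj_of_ne eR eC σ σ' hoff hc
  have h2 := adj_of_ne eR eC σ σ' hoff hc'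
  rw [hσc'] at h2
  exact pot_step Φ hcore hiv hk h1.1 h2.2 (fun h => hc'c (eC.symm.injective h).symm) h2.1
    fun h => hc'c (σ'.injective (eR.symm.injective h))

/-- **`stub_qPotential` for an abstract potential.**  Given any potential `Φ` with the prescribed
values on core and internal columns, two permutation monomials agreeing off the placed block graph
(`k ≥ 1`) are equal or differ by `τ = σ⁻¹ σ'` with `2k + 1 ∣ orderOf τ`. [folklore] -/
theorem stub_qPotential_of_pot (hk : 0 < k)
    (hoff : ∀ e ∉ placedBlock eR eC, permMonomial σ e = permMonomial σ' e) :
    σ = σ' ∨ (2 * k + 1) ∣ orderOf (σ⁻¹ * σ') := by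
  by_cases hσ : σ = σ'
  · exact Or.inl hσ
  right
  have hne : σ⁻¹ * σ' ≠ 1 := fun h => hσ (inv_mul_eq_one.mp h)
  refine dvd_orderOf_of_potential (σ⁻¹ * σ') (fun c => Φ (eR.symm (σ' c)) (eC.symm c))
    (fun c hc => ?_) hne
  have hτ : (σ⁻¹ * σ') c = σ.symm (σ' c) := rfl
  show Φ (eR.symm (σ' ((σ⁻¹ * σ') c))) (eC.symm ((σ⁻¹ * σ') c)) =
    Φ (eR.symm (σ' c)) (eC.symm c) + 1
  rw [hτ] at hc ⊢
  exact colPot_step eR eC σ σ' Φ hcore hiv hk hoff fun h =>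
    hc (by rw [Equiv.symm_apply_eq]; exact h.symm)

end Placed

/-! ### The registered stub -/

/-- **`stub_qPotential` (arithmetic rigidity of the block arsenal).**  If two permutation
monomials agree at every cell outside a placed block graph `placedBlock eR eC` (`k ≥ 1`), then
either the permutations are equal or `2k + 1` divides the order of `σ⁻¹ * σ'`: the potential
`Φ(core column) = -k`, `Φ(internal column (i,j,t)) = t + 1` forward / `-t` backward,
`Φ(padding column) = 0` increases by one along `τ = σ⁻¹ σ'` at every moved column
(`colPot_step`), so every cycle of `τ` has length divisible by `2k + 1`
(`dvd_orderOf_of_potential`). [folklore] -/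
theorem stub_qPotential :
    ∀ (b k m n : ℕ) (eR eC : BlockV b k m ≃ Fin n) (σ σ' : Equiv.Perm (Fin n)), 0 < k →
      (∀ e ∉ placedBlock eR eC, permMonomial σ e = permMonomial σ' e) →
      σ = σ' ∨ (2 * k + 1) ∣ orderOf (σ⁻¹ * σ') :=
  fun _ k _ _ eR eC σ σ' hk hoff =>
    stub_qPotential_of_pot eR eC σ σ'
      (fun R => Sum.elim (fun _ => -((k : ℕ) : ZMod (2 * k + 1)))
        (Sum.elim
          (fun p => if R = iv p.1 p.2.1 p.2.2 then ((p.2.2 : ℕ) : ZMod (2 * k + 1)) + 1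
            else -((p.2.2 : ℕ) : ZMod (2 * k + 1)))
          fun _ => 0))
      (fun _ _ => rfl) (fun _ _ _ _ => rfl) hk hoff

end Summit.ValiantsHypothesis.ValiantsHypothesis.Theorems.DivisionGapPerDivisionHard

end
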